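import Summits.HodgeConjecture.CorCM.Census.QuaternionColumnIndep
import Summits.HodgeConjecture.CorCM.Census.QuaternionColumnLaw

/-!
# The quaternion column, VIII-e: the pivot argument — `qfam` is fibre-independent, and the LAW `μ(Q_{2^{m+2}}, c) = φ₂`

COR-CM (cell `pub-hodgecm2`), count-neutral kernel combinatorics by the binder seat b09 (gen 39; lane QUATERNION COLUMN), part VIII-e, on parts
VIII-a…d and VII (`Census/QuaternionColumn{Blocks,Distinct,Characters,Indep,Law}.lean`) and `Splitting.linearIndepOn_of_pivot`
(`Census/TwoAdicSplitting.lean`) used BY NAME.  Theorems only: no definition, no `decide` beyond closed identities in `𝔽₂`, no certificate, no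
named fact, no `sorry`.  HONEST FRAMING: `HC_CM` is NOT proved, here or anywhere in the tree; nothing here is a period or a headline.

THE PIVOTS.  On the index set of part VIII-d, after replacing the two biarc faces `fplus (n−2) 0`, `fplus (n−1) 0` by the two biarc parity
cycles (part VIII-c; elementary operations, part VIII-d §1), the functional vectors `(par, θ_{χ_a}, θ_{χ_b})` are unitriangular for the ranks
`f_i ↦ 8n−2i` (pivot `blk U_i`), `c_i ↦ 8n−2i−1` (`blk C_i`), `f'_j ↦ 4n−2j` (`blk V_j`), `c'_j ↦ 4n−2j−1` (`blk C'_j`),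
`fplus k 0 ↦ k+2` (`blk (barc (k+2) 0)`, `k ≤ n−3`), even cycle `↦ 1` (pivot `θ_{χ_b}`), odd cycle `↦ 0` (pivot `θ_{χ_a}`); the off-pivot
vanishing is the distinctness of the near blocks (part VIII-b) and the potentials (`1` for single flips, `2` for the coincidence types).

**THEOREM (`qfam_fibreIndep`)**: for `n = 2^m ≥ 4` the explicit family `qfam n` is fibre-independent.
**THE QUATERNION LAW (`isLeast_card_gfaces_generate_quaternion`)**: for `n = 2^m ≥ 4`, `G = Q_{4n}`, `c = a n`:
the least number of rank-four face relations whose base changes generate the integer Hodge lattice modulo pairs is EXACTLY `φ₂(G, c)`.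

## References
* [Pohlmann1968] H. Pohlmann, Algebraic cycles on abelian varieties of complex multiplication type, Ann. of Math. 88 (1968), Thm 1.
-/

namespace Summit.HodgeConjecture.CorCM.Census.QuaternionColumn

open Finset QuaternionGroup
open Summit.HodgeConjecture.CorCM.Prior.AllgGroup.RfwfAllgGroup
open Summit.HodgeConjecture.CorCM.Census.BlockParity
open Summit.HodgeConjecture.CorCM.Census.Coinvariant
open Summit.HodgeConjecture.CorCM.Census.HalfParity
open Summit.HodgeConjecture.CorCM.Census.Splitting
open Summit.HodgeConjecture.CorCM.Census.BaseBlock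
open Summit.HodgeConjecture.CorCM.Census.TwistGeneration

noncomputable section

variable {n : ℕ} [NeZero n]

/-! ## §1 The pivot argument -/

/-- **THE FUNCTIONAL VECTORS OF THE EXPLICIT FAMILY ARE INDEPENDENT** (`n = 2^m ≥ 4`). [folklore] -/
theorem thetaVec_faceI_indep (m : ℕ) (hn : n = 2 ^ m) (h4 : 4 ≤ n) :
    LinearIndepOn (ZMod 2) (fun x => thetaVec (faceI n x)) (idxSet n) := by
  classical
  have heven := even_of_pow m hn h4
  have hhalf : 2 * (n / 2) = n := by obtain ⟨k, hk⟩ := heven; omega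
  set v : ℕ ⊕ ℕ ⊕ ℕ ⊕ ℕ ⊕ ℕ → Block (c n) ⊕ Bool → ZMod 2 := fun x => thetaVec (faceI n x) with hv
  -- the two biarc parity cycles
  set ye := ∑ t ∈ range (n / 2), fplus (((2 * t + 0 : ℕ) : ℕ) : ZMod (2 * n)) 0 with hye
  set yo := ∑ t ∈ range (n / 2), fplus (((2 * t + 1 : ℕ) : ℕ) : ZMod (2 * n)) 0 with hyo
  have hsum : ∀ r : ℕ, r ≤ 1 → v (Sum.inl (n - 2 + r)) + ∑ t ∈ range (n / 2 - 1), v (Sum.inl (2 * t + r)) =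
      thetaVec (∑ t ∈ range (n / 2), fplus (((2 * t + r : ℕ) : ℕ) : ZMod (2 * n)) 0) := by
    intro r hr
    conv_rhs => rw [show n / 2 = (n / 2 - 1) + 1 by omega]
    rw [sum_range_succ, thetaVec_add, thetaVec_sum, add_comm, show 2 * (n / 2 - 1) + r = n - 2 + r by omega]
    rfl
  have he0 : (Sum.inl (n - 2) : ℕ ⊕ ℕ ⊕ ℕ ⊕ ℕ ⊕ ℕ) ∈ idxSet n := (by change n - 2 < n; omega)
  have he1 : (Sum.inl (n - 1) : ℕ ⊕ ℕ ⊕ ℕ ⊕ ℕ ⊕ ℕ) ∈ idxSet n := (by change n - 1 < n; omega)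
  -- first elementary operation: the even cycle
  refine linearIndepOn_of_update_add v (idxSet n) (Sum.inl (n - 2)) he0 (∑ t ∈ range (n / 2 - 1), v (Sum.inl (2 * t + 0))) ?_ ?_
  · refine Submodule.sum_mem _ fun t ht => Submodule.subset_span ⟨Sum.inl (2 * t + 0), ⟨?_, ?_⟩, rfl⟩
    · change 2 * t + 0 < n; rw [mem_range] at ht; omega
    · rw [mem_range] at ht; simp only [Set.mem_singleton_iff, Sum.inl.injEq]; omega
  set v1 := Function.update v (Sum.inl (n - 2)) (v (Sum.inl (n - 2)) + ∑ t ∈ range (n / 2 - 1), v (Sum.inl (2 * t + 0))) with hv1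
  have hv1_of_ne : ∀ x, x ≠ Sum.inl (n - 2) → v1 x = v x := fun x hx => Function.update_of_ne hx _ _
  have hv1_e0 : v1 (Sum.inl (n - 2)) = thetaVec ye := by
    rw [hv1, Function.update_self, hye, ← hsum 0 (by omega), add_zero]
  -- second elementary operation: the odd cycle
  refine linearIndepOn_of_update_add v1 (idxSet n) (Sum.inl (n - 1)) he1 (∑ t ∈ range (n / 2 - 1), v (Sum.inl (2 * t + 1))) ?_ ?_
  · refine Submodule.sum_mem _ fun t ht => ?_
    rw [mem_range] at ht
    rw [← hv1_of_ne (Sum.inl (2 * t + 1)) (by simp only [ne_eq, Sum.inl.injEq]; omega)]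
    refine Submodule.subset_span ⟨Sum.inl (2 * t + 1), ⟨?_, ?_⟩, rfl⟩
    · change 2 * t + 1 < n; omega
    · simp only [Set.mem_singleton_iff, Sum.inl.injEq]; omega
  set v2 := Function.update v1 (Sum.inl (n - 1)) (v1 (Sum.inl (n - 1)) + ∑ t ∈ range (n / 2 - 1), v (Sum.inl (2 * t + 1))) with hv2
  have hv2_e1 : v2 (Sum.inl (n - 1)) = thetaVec yo := by
    rw [hv2, Function.update_self, hv1_of_ne _ (by simp only [ne_eq, Sum.inl.injEq]; omega), hyo, ← hsum 1 le_rfl,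
      show n - 2 + 1 = n - 1 by omega]
  have hv2_e0 : v2 (Sum.inl (n - 2)) = thetaVec ye := by
    rw [hv2, Function.update_of_ne (by simp only [ne_eq, Sum.inl.injEq]; omega), hv1_e0]
  have hv2_of_ne : ∀ x, x ≠ Sum.inl (n - 2) → x ≠ Sum.inl (n - 1) → v2 x = thetaVec (faceI n x) := fun x h0 h1 => by
    rw [hv2, Function.update_of_ne h1, hv1_of_ne x h0]
  -- the cycle values
  have hye_inl : ∀ B, thetaVec ye (Sum.inl B) = 0 := fun B => by show par (c n) ye B = 0; rw [hye, par_cycle heven 0]; rfl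
  have hyo_inl : ∀ B, thetaVec yo (Sum.inl B) = 0 := fun B => by show par (c n) yo B = 0; rw [hyo, par_cycle heven 1]; rfl
  have htab := theta_table m hn (by omega)
  have hye_f : thetaVec ye (Sum.inr false) = 1 := htab.1
  have hye_t : thetaVec ye (Sum.inr true) = 1 := htab.2.1
  have hyo_f : thetaVec yo (Sum.inr false) = 1 := htab.2.2.1
  have hyo_t : thetaVec yo (Sum.inr true) = 0 := htab.2.2.2
  -- shorthand facts
  have hmemB : ∀ i : ℕ, i < n → (a (i : ZMod (2 * n)) : QuaternionGroup n) ∈ (barc (0 : ZMod (2 * n)) 0).1 ∧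
      (xa (i : ZMod (2 * n)) : QuaternionGroup n) ∈ (barc (0 : ZMod (2 * n)) 0).1 := fun i hi => natCast_mem_base hi
  have hsp := blk_specials (n := n) (by omega)
  -- the pivot
  refine linearIndepOn_of_pivot (K := ZMod 2) v2 (idxSet n)
    (fun x => match x with
      | Sum.inl k => if k + 1 = n then Sum.inr false else if k + 2 = n then Sum.inr true else Sum.inl (blk (c n) (barc ((k + 2 : ℕ) : ZMod (2 * n)) 0))
      | Sum.inr (Sum.inl i) => Sum.inl (blk (c n) (oflipCM (c n) c_mul_c (a (i : ZMod (2 * n))) (barc 0 0)))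
      | Sum.inr (Sum.inr (Sum.inl i)) => Sum.inl (blk (c n) (oflipCM (c n) c_mul_c (a 0) (oflipCM (c n) c_mul_c (a ((i : ZMod (2 * n)) + 1)) (barc 0 0))))
      | Sum.inr (Sum.inr (Sum.inr (Sum.inl j))) => Sum.inl (blk (c n) (oflipCM (c n) c_mul_c (xa (j : ZMod (2 * n))) (barc 0 0)))
      | Sum.inr (Sum.inr (Sum.inr (Sum.inr j))) =>
          Sum.inl (blk (c n) (oflipCM (c n) c_mul_c (a 0) (oflipCM (c n) c_mul_c (xa ((j : ZMod (2 * n)) + 1)) (barc 0 0)))))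
    (fun x => match x with
      | Sum.inl k => if k + 1 = n then 0 else if k + 2 = n then 1 else k + 2
      | Sum.inr (Sum.inl i) => 8 * n - 2 * i
      | Sum.inr (Sum.inr (Sum.inl i)) => 8 * n - 2 * i - 1
      | Sum.inr (Sum.inr (Sum.inr (Sum.inl j))) => 4 * n - 2 * j
      | Sum.inr (Sum.inr (Sum.inr (Sum.inr j))) => 4 * n - 2 * j - 1) ?_ ?_
  · -- the diagonal
    rintro (k | i | i | j | j) hx
    · change k < n at hx
      by_cases hk1 : k + 1 = n
      · have ek : k = n - 1 := by omega
        subst ek; simp only [hk1, if_true, hv2_e1, hyo_f]; exact one_ne_zero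
      by_cases hk2 : k + 2 = n
      · have ek : k = n - 2 := by omega
        subst ek; simp only [hk1, if_false, hk2, if_true, hv2_e0, hye_t]; exact one_ne_zero
      simp only [hk1, hk2, if_false]
      rw [hv2_of_ne _ (by simp only [ne_eq, Sum.inl.injEq]; omega) (by simp only [ne_eq, Sum.inl.injEq]; omega)]
      show thetaVec (fplus ((k : ℕ) : ZMod (2 * n)) 0) _ ≠ 0
      rw [thetaVec_inl_fplus, if_neg (fun h => ?_), if_pos rfl]
      · exact one_ne_zero
      · have := blk_barc_natCast_inj (by omega) (by omega) h; omega
    · obtain ⟨hi1, hi2⟩ : 1 ≤ i ∧ i + 2 ≤ n := hx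
      rw [hv2_of_ne _ (by simp) (by simp)]
      show thetaVec (gface (c n) c_mul_c (barc 0 0) (a (i : ZMod (2 * n))) (xa (-1))) _ ≠ 0
      refine thetaVec_gface_third ((near_ne i hi1 hi2 0 0).1) ?_ ?_
      · rw [(blk_doubles h4 i).1]; exact ((flip_ne_coinc heven (hmemB i (by omega)).1 i hi1 hi2).1).symm
      · rw [hsp.1]; exact (near_ne i hi1 hi2 _ _).1
    · obtain ⟨hi1, hi2⟩ : 1 ≤ i ∧ i + 2 ≤ n := hx
      rw [hv2_of_ne _ (by simp) (by simp)]
      show thetaVec (gface (c n) c_mul_c (barc 0 0) (a 0) (a ((i : ZMod (2 * n)) + 1))) _ ≠ 0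
      refine thetaVec_gface_second ((near_ne i hi1 hi2 0 0).2.1) ?_ ?_
      · rw [hsp.2.1]; exact (near_ne i hi1 hi2 _ _).2.1
      · by_cases hi3 : i + 3 ≤ n
        · have h := (flip_ne_coinc heven (hmemB (i + 1) (by omega)).1 i hi1 hi2).1; rwa [Nat.cast_succ] at h
        · have ei : i = n - 2 := by omega
          subst ei; rw [hsp.2.2]; exact (near_ne _ hi1 hi2 _ _).2.1
    · obtain ⟨hj1, hj2⟩ : 1 ≤ j ∧ j + 2 ≤ n := hx
      rw [hv2_of_ne _ (by simp) (by simp)]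
      show thetaVec (gface (c n) c_mul_c (barc 0 0) (xa (j : ZMod (2 * n))) (xa (-1))) _ ≠ 0
      refine thetaVec_gface_third ((near_ne j hj1 hj2 0 0).2.2.1) ?_ ?_
      · rw [(blk_doubles h4 j).2.1]
        by_cases hj3 : j + 3 ≤ n
        · exact ((flip_ne_coinc heven (hmemB j (by omega)).2 j hj1 hj2).2 hj3).symm
        · have ej : j = n - 2 := by omega
          subst ej; rw [(blk_doubles h4 0).2.2]; exact (near_ne _ hj1 hj2 _ _).2.2.1
      · rw [hsp.1]; exact (near_ne j hj1 hj2 _ _).2.2.1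
    · obtain ⟨hj1, hj3⟩ : 1 ≤ j ∧ j + 3 ≤ n := hx
      rw [hv2_of_ne _ (by simp) (by simp)]
      show thetaVec (gface (c n) c_mul_c (barc 0 0) (a 0) (xa ((j : ZMod (2 * n)) + 1))) _ ≠ 0
      refine thetaVec_gface_second ((near_ne j hj1 (by omega) 0 0).2.2.2 hj3) ?_ ?_
      · rw [hsp.2.1]; exact (near_ne j hj1 (by omega) _ _).2.2.2 hj3
      · have h := (flip_ne_coinc heven (hmemB (j + 1) (by omega)).2 j hj1 (by omega)).2 hj3; rwa [Nat.cast_succ] at h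
  · -- off the pivots
    have hcs : ∀ i : ℕ, ((i : ℕ) : ZMod (2 * n)) + 1 = ((i + 1 : ℕ) : ℕ) := fun i => by push_cast; ring
    have hmemB' : ∀ i : ℕ, i + 1 < n → (a (((i : ℕ) : ZMod (2 * n)) + 1) : QuaternionGroup n) ∈ (barc (0 : ZMod (2 * n)) 0).1 ∧
        (xa (((i : ℕ) : ZMod (2 * n)) + 1) : QuaternionGroup n) ∈ (barc (0 : ZMod (2 * n)) 0).1 := fun i hi => by
      rw [hcs]; exact hmemB (i + 1) hi
    -- the biarc members (and the two cycles) vanish at every block missed by their outer corners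
    have hbi : ∀ k' : ℕ, k' < n → ∀ B : Block (c n),
        (k' + 3 ≤ n → B ≠ blk (c n) (barc ((k' : ℕ) : ZMod (2 * n)) 0) ∧ B ≠ blk (c n) (barc ((k' + 2 : ℕ) : ZMod (2 * n)) 0)) →
        v2 (Sum.inl k') (Sum.inl B) = 0 := by
      intro k' hk' B hB
      by_cases h1 : k' + 1 = n
      · rw [show k' = n - 1 by omega, hv2_e1]; exact hyo_inl B
      by_cases h2 : k' + 2 = n
      · rw [show k' = n - 2 by omega, hv2_e0]; exact hye_inl B
      rw [hv2_of_ne _ (by simp only [ne_eq, Sum.inl.injEq]; omega) (by simp only [ne_eq, Sum.inl.injEq]; omega)]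
      obtain ⟨hB1, hB2⟩ := hB (by omega)
      show thetaVec (fplus ((k' : ℕ) : ZMod (2 * n)) 0) (Sum.inl B) = 0
      rw [thetaVec_inl_fplus, if_neg hB1, if_neg hB2, add_zero]
    rintro x hx y hy hxy hle
    rcases y with k | i | i | j | j
    · -- pivot of a biarc member / cycle
      change k < n at hy
      by_cases hk1 : k + 1 = n
      · exfalso
        simp only [hk1, if_true, Nat.le_zero] at hle
        rcases x with k' | i' | i' | j' | j' <;> dsimp only at hle
        · change k' < n at hx
          by_cases hk'1 : k' + 1 = n
          · exact hxy (by rw [show k' = k by omega])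
          by_cases hk'2 : k' + 2 = n
          · rw [if_neg hk'1, if_pos hk'2] at hle; omega
          · rw [if_neg hk'1, if_neg hk'2] at hle; omega
        all_goals (obtain ⟨hx1, hx2⟩ := hx; omega)
      by_cases hk2 : k + 2 = n
      · simp only [hk1, if_false, hk2, if_true] at hle ⊢
        rcases x with k' | i' | i' | j' | j' <;> dsimp only at hle
        · change k' < n at hx
          by_cases hk'1 : k' + 1 = n
          · rw [show k' = n - 1 by omega, hv2_e1, hyo_t]
          by_cases hk'2 : k' + 2 = n
          · exact (hxy (by rw [show k' = k by omega])).elim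
          · rw [if_neg hk'1, if_neg hk'2] at hle; omega
        all_goals (obtain ⟨hx1, hx2⟩ := hx; omega)
      simp only [hk1, hk2, if_false] at hle ⊢
      rcases x with k' | i' | i' | j' | j' <;> dsimp only at hle
      · change k' < n at hx
        refine hbi k' hx _ fun hk'3 => ⟨fun h => ?_, fun h => ?_⟩
        · have := blk_barc_natCast_inj (by omega) (by omega) h
          by_cases hk'1 : k' + 1 = n
          · omega
          by_cases hk'2 : k' + 2 = n
          · omega
          rw [if_neg hk'1, if_neg hk'2] at hle; omega
        · have := blk_barc_natCast_inj (by omega) (by omega) h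
          have : k' ≠ k := fun e => hxy (by rw [e])
          omega
      all_goals (obtain ⟨hx1, hx2⟩ := hx; omega)
    · -- pivot `blk U_i` of `f_i`
      obtain ⟨hi1, hi2⟩ : 1 ≤ i ∧ i + 2 ≤ n := hy
      have hU := fun p q => (near_ne i hi1 hi2 p q).1
      dsimp only at hle ⊢
      rcases x with k' | i' | i' | j' | j' <;> dsimp only at hle
      · exact hbi k' hx _ fun _ => ⟨hU _ _ |>.symm, hU _ _ |>.symm⟩
      · obtain ⟨hx1, hx2⟩ : 1 ≤ i' ∧ i' + 2 ≤ n := hx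
        have hne : i' ≠ i := fun e => hxy (by rw [e])
        rw [hv2_of_ne _ (by simp) (by simp)]
        refine thetaVec_gface_eq_zero (hU 0 0) ?_ (fun h => hne (blk_U_inj hx1 hx2 hi1 hi2 h)) (by rw [hsp.1]; exact hU _ _)
        rw [(blk_doubles h4 i').1]; exact ((flip_ne_coinc heven (hmemB i (by omega)).1 i' hx1 hx2).1).symm
      · obtain ⟨hx1, hx2⟩ : 1 ≤ i' ∧ i' + 2 ≤ n := hx
        rw [hv2_of_ne _ (by simp) (by simp)]
        refine thetaVec_gface_eq_zero (hU 0 0) ((flip_ne_coinc heven (hmemB i (by omega)).1 i' hx1 hx2).1.symm)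
          (by rw [hsp.2.1]; exact hU _ _) ?_
        by_cases hx3 : i' + 3 ≤ n
        · intro h; rw [hcs i'] at h; have := blk_U_inj (by omega) (by omega) hi1 hi2 h; omega
        · have ei : i' = n - 2 := by omega
          subst ei; rw [hsp.2.2]; exact hU _ _
      · obtain ⟨hx1, hx2⟩ : 1 ≤ j' ∧ j' + 2 ≤ n := hx
        rw [hv2_of_ne _ (by simp) (by simp)]
        refine thetaVec_gface_eq_zero (hU 0 0) ?_ (blk_U_ne_V h4 hi1 hi2 hx1 hx2).symm (by rw [hsp.1]; exact hU _ _)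
        rw [(blk_doubles h4 j').2.1]
        by_cases hx3 : j' + 3 ≤ n
        · exact ((flip_ne_coinc heven (hmemB i (by omega)).1 j' hx1 hx2).2 hx3).symm
        · have ej : j' = n - 2 := by omega
          subst ej; rw [(blk_doubles h4 0).2.2]; exact hU _ _
      · obtain ⟨hx1, hx3⟩ : 1 ≤ j' ∧ j' + 3 ≤ n := hx
        rw [hv2_of_ne _ (by simp) (by simp)]
        refine thetaVec_gface_eq_zero (hU 0 0) ((flip_ne_coinc heven (hmemB i (by omega)).1 j' hx1 (by omega)).2 hx3).symm
          (by rw [hsp.2.1]; exact hU _ _) ?_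
        rw [hcs j']; exact (blk_U_ne_V h4 hi1 hi2 (j := j' + 1) (by omega) (by omega)).symm
    · -- pivot `blk C_i` of `c_i`
      obtain ⟨hi1, hi2⟩ : 1 ≤ i ∧ i + 2 ≤ n := hy
      have hC := fun p q => (near_ne i hi1 hi2 p q).2.1
      dsimp only at hle ⊢
      rcases x with k' | i' | i' | j' | j' <;> dsimp only at hle
      · exact hbi k' hx _ fun _ => ⟨hC _ _ |>.symm, hC _ _ |>.symm⟩
      · obtain ⟨hx1, hx2⟩ : 1 ≤ i' ∧ i' + 2 ≤ n := hx
        rw [hv2_of_ne _ (by simp) (by simp)]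
        refine thetaVec_gface_eq_zero (hC 0 0) ?_ ((flip_ne_coinc heven (hmemB i' (by omega)).1 i hi1 hi2).1) (by rw [hsp.1]; exact hC _ _)
        rw [(blk_doubles h4 i').1]; intro h; have := blk_C_inj hx1 hx2 hi1 hi2 h; omega
      · obtain ⟨hx1, hx2⟩ : 1 ≤ i' ∧ i' + 2 ≤ n := hx
        have hne : i' ≠ i := fun e => hxy (by rw [e])
        rw [hv2_of_ne _ (by simp) (by simp)]
        refine thetaVec_gface_eq_zero (hC 0 0) (fun h => hne (blk_C_inj hx1 hx2 hi1 hi2 h)) (by rw [hsp.2.1]; exact hC _ _) ?_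
        by_cases hx3 : i' + 3 ≤ n
        · exact (flip_ne_coinc heven (hmemB' i' (by omega)).1 i hi1 hi2).1
        · have ei : i' = n - 2 := by omega
          subst ei; rw [hsp.2.2]; exact hC _ _
      · obtain ⟨hx1, hx2⟩ : 1 ≤ j' ∧ j' + 2 ≤ n := hx
        rw [hv2_of_ne _ (by simp) (by simp)]
        refine thetaVec_gface_eq_zero (hC 0 0) ?_ ((flip_ne_coinc heven (hmemB j' (by omega)).2 i hi1 hi2).1) (by rw [hsp.1]; exact hC _ _)
        rw [(blk_doubles h4 j').2.1]
        by_cases hx3 : j' + 3 ≤ n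
        · exact (blk_C_ne_C' h4 hi1 hi2 hx1 hx3).symm
        · have ej : j' = n - 2 := by omega
          subst ej; rw [(blk_doubles h4 0).2.2]; exact hC _ _
      · obtain ⟨hx1, hx3⟩ : 1 ≤ j' ∧ j' + 3 ≤ n := hx
        rw [hv2_of_ne _ (by simp) (by simp)]
        exact thetaVec_gface_eq_zero (hC 0 0) (blk_C_ne_C' h4 hi1 hi2 hx1 hx3).symm (by rw [hsp.2.1]; exact hC _ _)
          ((flip_ne_coinc heven (hmemB' j' (by omega)).2 i hi1 hi2).1)
    · -- pivot `blk V_j` of `f'_j`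
      obtain ⟨hj1, hj2⟩ : 1 ≤ j ∧ j + 2 ≤ n := hy
      have hV := fun p q => (near_ne j hj1 hj2 p q).2.2.1
      dsimp only at hle ⊢
      rcases x with k' | i' | i' | j' | j' <;> dsimp only at hle
      · exact hbi k' hx _ fun _ => ⟨hV _ _ |>.symm, hV _ _ |>.symm⟩
      · obtain ⟨hx1, hx2⟩ : 1 ≤ i' ∧ i' + 2 ≤ n := hx; exfalso; omega
      · obtain ⟨hx1, hx2⟩ : 1 ≤ i' ∧ i' + 2 ≤ n := hx; exfalso; omega
      · obtain ⟨hx1, hx2⟩ : 1 ≤ j' ∧ j' + 2 ≤ n := hx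
        have hne : j' ≠ j := fun e => hxy (by rw [e])
        rw [hv2_of_ne _ (by simp) (by simp)]
        refine thetaVec_gface_eq_zero (hV 0 0) ?_ (fun h => hne (blk_V_inj hx1 hx2 hj1 hj2 h)) (by rw [hsp.1]; exact hV _ _)
        rw [(blk_doubles h4 j').2.1]
        by_cases hx3 : j' + 3 ≤ n
        · exact ((flip_ne_coinc heven (hmemB j (by omega)).2 j' hx1 hx2).2 hx3).symm
        · have ej : j' = n - 2 := by omega
          subst ej; rw [(blk_doubles h4 0).2.2]; exact hV _ _
      · obtain ⟨hx1, hx3⟩ : 1 ≤ j' ∧ j' + 3 ≤ n := hx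
        rw [hv2_of_ne _ (by simp) (by simp)]
        refine thetaVec_gface_eq_zero (hV 0 0) ((flip_ne_coinc heven (hmemB j (by omega)).2 j' hx1 (by omega)).2 hx3).symm
          (by rw [hsp.2.1]; exact hV _ _) ?_
        intro h; rw [hcs j'] at h; have := blk_V_inj (by omega) (by omega) hj1 hj2 h; omega
    · -- pivot `blk C'_j` of `c'_j`
      obtain ⟨hj1, hj3⟩ : 1 ≤ j ∧ j + 3 ≤ n := hy
      have hC' := fun p q => (near_ne j hj1 (by omega) p q).2.2.2 hj3
      dsimp only at hle ⊢
      rcases x with k' | i' | i' | j' | j' <;> dsimp only at hle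
      · exact hbi k' hx _ fun _ => ⟨hC' _ _ |>.symm, hC' _ _ |>.symm⟩
      · obtain ⟨hx1, hx2⟩ : 1 ≤ i' ∧ i' + 2 ≤ n := hx; exfalso; omega
      · obtain ⟨hx1, hx2⟩ : 1 ≤ i' ∧ i' + 2 ≤ n := hx; exfalso; omega
      · obtain ⟨hx1, hx2⟩ : 1 ≤ j' ∧ j' + 2 ≤ n := hx
        rw [hv2_of_ne _ (by simp) (by simp)]
        refine thetaVec_gface_eq_zero (hC' 0 0) ?_ ((flip_ne_coinc heven (hmemB j' (by omega)).2 j hj1 (by omega)).2 hj3)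
          (by rw [hsp.1]; exact hC' _ _)
        rw [(blk_doubles h4 j').2.1]
        by_cases hx3 : j' + 3 ≤ n
        · intro h; have := blk_C'_inj hx1 hx3 hj1 hj3 h; omega
        · have ej : j' = n - 2 := by omega
          subst ej; rw [(blk_doubles h4 0).2.2]; exact hC' _ _
      · obtain ⟨hx1, hx3⟩ : 1 ≤ j' ∧ j' + 3 ≤ n := hx
        have hne : j' ≠ j := fun e => hxy (by rw [e])
        rw [hv2_of_ne _ (by simp) (by simp)]
        exact thetaVec_gface_eq_zero (hC' 0 0) (fun h => hne (blk_C'_inj hx1 hx3 hj1 hj3 h)) (by rw [hsp.2.1]; exact hC' _ _)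
          ((flip_ne_coinc heven (hmemB' j' (by omega)).2 j hj1 (by omega)).2 hj3)

/-- **THE EXPLICIT FAMILY IS FIBRE-INDEPENDENT** (`n = 2^m ≥ 4`). [folklore] -/
theorem qfam_fibreIndep (m : ℕ) (hn : n = 2 ^ m) (h4 : 4 ≤ n) :
    LinearIndepOn (ZMod 2) (fun f : CMF (QuaternionGroup n) (c n) →₀ ℤ => (rad2 (c n) c_mul_c).mkQ (red (c n) f)) ↑(qfam n) := by
  refine fibreIndep_of_thetaVec m hn (by omega) _ ?_
  rw [coe_qfam_eq_image]
  exact LinearIndepOn.image_of_comp (faceI n) (fun f => thetaVec f) (thetaVec_faceI_indep m hn h4)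

/-! ## §2 The law -/

/-- **THE QUATERNION LAW `μ(Q_{2^{m+2}}, c) = φ₂(Q_{2^{m+2}}, c)`**: for `n = 2^m ≥ 4`, `G = Q_{4n} = QuaternionGroup n`, `c = a n`, the least
number of rank-four face relations whose base changes generate the integer Hodge lattice of `(G, c)` modulo pairs is EXACTLY the coinvariant
fibre dimension `φ₂(G, c)`. [folklore] -/
theorem isLeast_card_gfaces_generate_quaternion (m : ℕ) (hn : n = 2 ^ m) (h4 : 4 ≤ n) :
    IsLeast {k : ℕ | ∃ S : Finset (CMF (QuaternionGroup n) (c n) →₀ ℤ), (↑S ⊆ gfaceSet (QuaternionGroup n) (c n) c_mul_c) ∧ S.card = k ∧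
      hodgeSpan (c n) c_mul_c ≤ Submodule.span ℤ (pairSet (c n)) ⊔ Submodule.span ℤ (translates (c n) S)} (fibreTwo (c n) c_mul_c) :=
  isLeast_card_gfaces_generate_of_indep m hn h4 (qfam_fibreIndep m hn h4)


end

end Summit.HodgeConjecture.CorCM.Census.QuaternionColumn
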